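import Mathlib.Geometry.Manifold.LocalDiffeomorph
import Mathlib.Geometry.Manifold.Instances.Real
import Mathlib.Analysis.InnerProductSpace.PiL2
import Mathlib.Analysis.InnerProductSpace.Calculus
import Mathlib.Analysis.Complex.Basic
import HarnessLib

/-!
# Branched double quotients of a `4`-manifold by an involution with a standard local model
# (the Arnold–Kuiper–Massey / Finashin quotient `X → X/conj`)

Topic `Topology/FourManifolds`; namespace `Literature.Topology.FourManifolds`. A DEFINITION file
(requested notion `IsBranchedDoubleQuotient`, for route `SmoothPoincare4/RealQuotientSpheres`,
items `RqExotic` / `RqStandard` / `RqQuotientExists` / `RqWahlBallSwap`).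

The construction. Let `X` be a complex surface with an anti-holomorphic involution `σ = conj`
whose fixed-point set `X_ℝ = Fix σ` is a real surface. In `σ`-adapted holomorphic coordinates
`(z, w)` near a real point, `σ(z, w) = (z̄, w̄)` and `X_ℝ = {Im z = Im w = 0}`; the orbit space
`Y = X/σ` is a topological `4`-manifold and carries a unique smooth structure for which the
projection `q : X → Y` is smooth, a local diffeomorphism off `X_ℝ`, and near `X_ℝ` is the
`2`-fold covering branched along `X_ℝ` with local model
`(z, w) ↦ (Re z, Re w, (Im z)² − (Im w)², 2 Im z · Im w)` — the identity on the real directions and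
the squaring map `v ↦ v²` of `ℂ ≅ ℝ²` (the normal plane of `X_ℝ`, on which `σ` acts by `−1`) —
Finashin (1996), §1 ¶2: "The quotient `Y` inherits from `X` an orientation and a smooth structure,
which makes the projection `q : X → Y` an orientation preserving and smooth `2`-fold covering
branched along the real part `X_ℝ` of `X`, the fixed point set of conj"; the smooth structure on
`ℂℙ²/conj ≅ S⁴` of Kuiper (1974) and Massey (1973), and Arnold's remark; uniqueness of the
structure from the equivariant tubular neighbourhood theorem (Bredon 1972, VI.2).

## What is defined

* `branchedDoubleModel : (Fin 2 → ℂ) → ℝ⁴`, `(z, w) ↦ (Re z, Re w, (Im z)² − (Im w)², 2 Im z Im w)`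
  — the standard local model of the quotient map at a branch point; proved: it is invariant
  under coordinatewise conjugation (`branchedDoubleModel_star`), its fibres are EXACTLY the
  conjugate pairs (`branchedDoubleModel_eq_iff`: the squaring map of `ℂ` is `2 : 1` onto `ℂ`
  with fibres `±v`), and it is `C^∞` (`contDiff_branchedDoubleModel`).
* `IsBranchedDoubleQuotient σ q` — for `X` a `C^∞` manifold modelled on `𝓘(ℝ, Fin 2 → ℂ)` (the
  real manifold underlying a complex surface, charts valued in `ℂ²`), `σ : X → X`, `Y` modelled on
  `𝓡 4`, and `q : X → Y`: `q` is a topological quotient map whose fibres are exactly the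
  `σ`-orbits `{x, σ x}`, `q` is `C^∞`, a local diffeomorphism at every non-fixed point of `σ`, and
  every fixed point `x` of `σ` lies in the source of a chart `φ` of the `C^∞` structure of `X`
  (`φ ∈ maximalAtlas`) which is `σ`-adapted — its source is `σ`-invariant and
  `φ (σ y) = conj (φ y)` coordinatewise (`star`) — and is carried by `q` into a chart `ψ` of the
  `C^∞` structure of `Y` in which `q` IS the model: `ψ (q y) = branchedDoubleModel (φ y)`.
  Consequences proved here: `q ∘ σ = q`, `q` is surjective and continuous, and `σ` is an
  involution (`IsBranchedDoubleQuotient.involutive`: the fibre condition forces `σ (σ x) = x`);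
  at a fixed point the adapted chart takes real values (`apply_fixed_eq_star`).

Smoothness/involutivity of `σ` and the manifold axioms (`IsManifold … X`, `IsManifold … Y`) are
NOT fields: as for the tree's relational predicates `IsRealProjectiveSpace`, `IsConnectedSum`,
consumers add them as hypotheses. Deliberately not here (they are the route's items / later
lemmas, each a theorem about this predicate, not part of its definition): EXISTENCE of `(Y, q)`
for an anti-holomorphic involution with real points on a compact complex surface
(`RqQuotientExists`) and UNIQUENESS of `Y` up to diffeomorphism (Bredon VI.2).

## Non-vacuity

The model itself — `X = ℂ²` (`Fin 2 → ℂ`), `σ = conj` coordinatewise (`star`), `Y = ℝ⁴`,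
`q = branchedDoubleModel` — satisfies the fibre clause (`branchedDoubleModel_eq_iff`), the
smoothness clause (`contDiff_branchedDoubleModel`) and the chart clause (identity charts), as
checked in the seat's scratch file; it is moreover proper (`‖q v‖² = |Re v|² + |Im v|⁴`) and
surjective, hence a quotient map, and a local diffeomorphism off `Fix conj = ℝ²` (Jacobian
`4((Im z)² + (Im w)²) ≠ 0`), so it is an instance of `IsBranchedDoubleQuotient`; these two analytic
clauses (properness, inverse function theorem) are not formalised in this definition file. The
motivating compact instance is Kuiper–Massey's `ℂℙ² → ℂℙ²/conj ≅ S⁴`.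

## Mathlib / tree search

Mathlib: `Topology.IsQuotientMap`, `ContMDiff`, `IsLocalDiffeomorphAt`, `IsManifold.maximalAtlas`,
`modelWithCornersSelf` (`𝓘(ℝ, Fin 2 → ℂ)`), `𝓡 4`, `EuclideanSpace`, `star` on `Fin 2 → ℂ`
(coordinatewise `conj`), `contDiff_euclidean`; no branched coverings (`lean search 'branched|
Branched'`: only prose). Tree: the relational quotient predicates `IsRealProjectiveSpace`
(`RealProjectiveSpace.lean`: fibres `y = x ∨ y = -x`) and the cyclic branched-cover clause inlined
in route `QuotientSpheres` (local model `(x₂ + i x₃)ⁿ` on `S⁴`) — a different local model (branch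
locus of codimension `2` in the quotient of a `4`-manifold by a cyclic action with `2`-dimensional
fixed set, versus the conjugation quotient here, whose branch locus `q(X_ℝ)` is again a surface but
the covering space is the complex surface); neither is reused.

## References

* S. Finashin, *Rokhlin conjecture and quotients of complex surfaces by complex conjugation*,
  J. reine angew. Math. 481 (1996), 55–71 = arXiv:dg-ga/9506007, §1 ¶2 (the smooth structure on
  `X/conj`). [Finashin1996]
* N. H. Kuiper, *The quotient space of `ℂP(2)` by complex conjugation is the `4`-sphere*, Math.
  Ann. 208 (1974), 175–177. [Kuiper1974]
* W. S. Massey, *The quotient space of the complex projective plane under conjugation is a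
  `4`-sphere*, Geom. Dedicata 2 (1973), 371–374. [Massey1973]
* G. E. Bredon, *Introduction to compact transformation groups*, Academic Press (1972), VI.2
  (equivariant tubular neighbourhoods). [Bredon1972]
-/

noncomputable section

open scoped Manifold ContDiff ComplexConjugate
open Set Function

namespace Literature.Topology.FourManifolds

/-! ### The local model `(z, w) ↦ (Re z, Re w, (Im z)² − (Im w)², 2 Im z Im w)` -/

/-- **The standard local model of a branched double quotient at a branch point**:
`ℂ² → ℝ⁴`, `(z, w) ↦ (Re z, Re w, (Im z)² − (Im w)², 2 · Im z · Im w)`, i.e. the identity on the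
real parts and the squaring map `v ↦ v²` of `ℂ ≅ ℝ²` on the imaginary parts `v = Im z + i Im w`
(the quotient of the normal plane of the real locus by `v ↦ -v`; Finashin 1996 p. 1, Kuiper 1974,
Massey 1973). [cite: Finashin1996, §1 Introduction ¶2 (arXiv:dg-ga/9506007 p. 1)] -/
def branchedDoubleModel (v : Fin 2 → ℂ) : EuclideanSpace ℝ (Fin 4) :=
  WithLp.toLp 2 ![(v 0).re, (v 1).re, (v 0).im ^ 2 - (v 1).im ^ 2, 2 * (v 0).im * (v 1).im]

/-- The coordinates of the local model (unfolding lemma). [folklore] -/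
theorem branchedDoubleModel_apply (v : Fin 2 → ℂ) (j : Fin 4) :
    branchedDoubleModel v j =
      ![(v 0).re, (v 1).re, (v 0).im ^ 2 - (v 1).im ^ 2, 2 * (v 0).im * (v 1).im] j :=
  rfl

/-- **The model is invariant under coordinatewise conjugation** `(z, w) ↦ (z̄, w̄)` (real parts
are kept, imaginary parts change sign, and the model is quadratic in them): it is constant on the
orbits of `conj`. [folklore] -/
theorem branchedDoubleModel_star (v : Fin 2 → ℂ) :
    branchedDoubleModel (star v) = branchedDoubleModel v := by
  ext j
  simp only [branchedDoubleModel_apply, Pi.star_apply, Complex.star_def, Complex.conj_re,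
    Complex.conj_im]
  fin_cases j <;> simp

/-- **The fibres of the local model are exactly the conjugate pairs**:
`branchedDoubleModel v = branchedDoubleModel v' ↔ v' = v ∨ v' = conj v` — the real parts agree and
`(Im z' + i Im w')² = (Im z + i Im w)²` in `ℂ`, so the imaginary parts agree up to a common sign.
This is the consistency of the chart clause of `IsBranchedDoubleQuotient` with its fibre clause.
[folklore] -/
theorem branchedDoubleModel_eq_iff (v v' : Fin 2 → ℂ) :
    branchedDoubleModel v = branchedDoubleModel v' ↔ v' = v ∨ v' = star v := by
  constructor
  · intro h
    have hj : ∀ j : Fin 4, branchedDoubleModel v j = branchedDoubleModel v' j := fun j => by rw [h]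
    have h0 := hj 0
    have h1 := hj 1
    have h2 := hj 2
    have h3 := hj 3
    simp only [branchedDoubleModel_apply, Matrix.cons_val_zero, Matrix.cons_val_one,
      Matrix.cons_val] at h0 h1 h2 h3
    -- the squaring map: `(Im z + i Im w)² = (Im z' + i Im w')²`
    set a : ℂ := ⟨(v 0).im, (v 1).im⟩ with ha
    set b : ℂ := ⟨(v' 0).im, (v' 1).im⟩ with hb
    have hsq : b ^ 2 = a ^ 2 := by
      apply Complex.ext
      · simp only [sq, Complex.mul_re, ha, hb]
        nlinarith [h2]
      · simp only [sq, Complex.mul_im, ha, hb]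
        linarith [h3]
    rcases sq_eq_sq_iff_eq_or_eq_neg.1 hsq with hab | hab
    · -- same imaginary parts: `v' = v`
      left
      have hre : b.re = a.re := by rw [hab]
      have him : b.im = a.im := by rw [hab]
      simp only [ha, hb] at hre him
      funext i
      fin_cases i
      · exact Complex.ext h0.symm hre
      · exact Complex.ext h1.symm him
    · -- opposite imaginary parts: `v' = conj v`
      right
      have hre : b.re = -a.re := by rw [hab, Complex.neg_re]
      have him : b.im = -a.im := by rw [hab, Complex.neg_im]
      simp only [ha, hb] at hre him
      funext i
      fin_cases i
      · exact Complex.ext (by simpa using h0.symm) (by simpa using hre)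
      · exact Complex.ext (by simpa using h1.symm) (by simpa using him)
  · rintro (rfl | rfl)
    · rfl
    · exact (branchedDoubleModel_star v).symm

/-- **The local model is `C^∞`** (its coordinates are polynomials in the real and imaginary parts,
which are `ℝ`-linear). [folklore] -/
theorem contDiff_branchedDoubleModel : ContDiff ℝ ∞ branchedDoubleModel := by
  rw [contDiff_euclidean]
  have hre : ∀ i : Fin 2, ContDiff ℝ ∞ fun v : Fin 2 → ℂ => (v i).re := fun i =>
    Complex.reCLM.contDiff.comp (contDiff_apply ℝ ℂ i)
  have him : ∀ i : Fin 2, ContDiff ℝ ∞ fun v : Fin 2 → ℂ => (v i).im := fun i =>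
    Complex.imCLM.contDiff.comp (contDiff_apply ℝ ℂ i)
  intro j
  fin_cases j
  · simpa [branchedDoubleModel_apply] using hre 0
  · simpa [branchedDoubleModel_apply] using hre 1
  · simpa [branchedDoubleModel_apply] using ((him 0).pow 2).sub ((him 1).pow 2)
  · simpa [branchedDoubleModel_apply, mul_assoc] using (contDiff_const.mul (him 0)).mul (him 1)

/-! ### The predicate -/

section Def

variable {X : Type*} [TopologicalSpace X] [ChartedSpace (Fin 2 → ℂ) X]
  {Y : Type*} [TopologicalSpace Y] [ChartedSpace (EuclideanSpace ℝ (Fin 4)) Y]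

/-- **`q : X → Y` is the branched double quotient of `X` by `σ` with the standard local model**
(the smooth structure on `X/conj` of Finashin 1996, §1: "The quotient `Y` inherits from `X` an
orientation and a smooth structure, which makes the projection `q : X → Y` an orientation
preserving and smooth `2`-fold covering branched along the real part `X_ℝ` of `X`, the fixed point
set of conj"; Kuiper 1974, Massey 1973 for `ℂℙ²`). Here `X` is a `C^∞` manifold modelled on
`𝓘(ℝ, Fin 2 → ℂ)` (charts valued in `ℂ²`, as for the real manifold underlying a complex surface),
`σ : X → X` (an anti-holomorphic involution in the applications), `Y` is modelled on `𝓡 4`, and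
the fields say: `q` is a topological quotient map (`isQuotientMap`) with fibres exactly the
`σ`-orbits, `q x = q y ↔ y = x ∨ y = σ x` (`apply_eq_iff`); `q` is `C^∞` (`contMDiff`) and a local
diffeomorphism at every point not fixed by `σ` (`isLocalDiffeomorphAt`); and every fixed point `x`
of `σ` lies in the source of a `σ`-adapted chart `φ` of the `C^∞` structure of `X` — `σ`-invariant
source, `φ (σ y) = conj (φ y)` coordinatewise — which `q` carries into a chart `ψ` of the `C^∞`
structure of `Y` where `q` is the model `(z, w) ↦ (Re z, Re w, (Im z)² − (Im w)², 2 Im z Im w)`: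
`ψ (q y) = branchedDoubleModel (φ y)` (`exists_adapted_charts`). The manifold axioms for `X`, `Y`
and the smoothness of `σ` are not fields (consumers assume them); `σ ∘ σ = id` follows
(`IsBranchedDoubleQuotient.involutive`). Orientations are not recorded.
[cite: Finashin1996, §1 Introduction ¶2 (arXiv:dg-ga/9506007 p. 1): the smooth structure on X/conj] -/
structure IsBranchedDoubleQuotient (σ : X → X) (q : X → Y) : Prop where
  /-- `q` is a topological quotient map (`Y` carries the quotient topology of `X/σ`). -/
  isQuotientMap : Topology.IsQuotientMap q
  /-- The fibres of `q` are exactly the `σ`-orbits `{x, σ x}`. -/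
  apply_eq_iff : ∀ x y : X, q x = q y ↔ y = x ∨ y = σ x
  /-- `q` is `C^∞`. -/
  contMDiff : ContMDiff 𝓘(ℝ, Fin 2 → ℂ) (𝓡 4) ∞ q
  /-- Off the fixed-point set of `σ`, `q` is a local diffeomorphism (an unbranched double cover). -/
  isLocalDiffeomorphAt : ∀ x : X, σ x ≠ x → IsLocalDiffeomorphAt 𝓘(ℝ, Fin 2 → ℂ) (𝓡 4) ∞ q x
  /-- At a fixed point of `σ`: a `σ`-adapted chart of `X` (`φ ∘ σ = conj ∘ φ` on a `σ`-invariant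
  source) carried by `q` into a chart of `Y` in which `q` is the standard model. -/
  exists_adapted_charts : ∀ x : X, σ x = x →
    ∃ φ ∈ IsManifold.maximalAtlas 𝓘(ℝ, Fin 2 → ℂ) ∞ X, ∃ ψ ∈ IsManifold.maximalAtlas (𝓡 4) ∞ Y,
      x ∈ φ.source ∧ ∀ y ∈ φ.source, σ y ∈ φ.source ∧ φ (σ y) = star (φ y) ∧
        q y ∈ ψ.source ∧ ψ (q y) = branchedDoubleModel (φ y)

end Def

/-! ### Consequences -/

namespace IsBranchedDoubleQuotient

variable {X : Type*} [TopologicalSpace X] [ChartedSpace (Fin 2 → ℂ) X]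
  {Y : Type*} [TopologicalSpace Y] [ChartedSpace (EuclideanSpace ℝ (Fin 4)) Y]
  {σ : X → X} {q : X → Y}

/-- `q` is constant on `σ`-orbits: `q (σ x) = q x`. [folklore] -/
theorem apply_σ (h : IsBranchedDoubleQuotient σ q) (x : X) : q (σ x) = q x :=
  ((h.apply_eq_iff x (σ x)).2 (Or.inr rfl)).symm

/-- `q` is surjective (a quotient map). [folklore] -/
theorem surjective (h : IsBranchedDoubleQuotient σ q) : Surjective q :=
  h.isQuotientMap.surjective

/-- `q` is continuous. [folklore] -/
theorem continuous (h : IsBranchedDoubleQuotient σ q) : Continuous q :=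
  h.isQuotientMap.continuous

/-- **`σ` is an involution**: the fibre condition applied to `q (σ (σ x)) = q x` gives
`σ (σ x) = x ∨ σ (σ x) = σ x`, and in the second case `σ x` is a fixed point with `q (σ x) = q x`,
whence `x = σ x`. [folklore] -/
theorem involutive (h : IsBranchedDoubleQuotient σ q) : Involutive σ := by
  intro x
  have hq : q x = q (σ (σ x)) := by rw [h.apply_σ, h.apply_σ]
  rcases (h.apply_eq_iff x (σ (σ x))).1 hq with h1 | h1
  · exact h1
  · -- `σ (σ x) = σ x`: then `x` and `σ x` have the same image and `σ x` is fixed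
    have hx : q (σ x) = q x := h.apply_σ x
    rcases (h.apply_eq_iff (σ x) x).1 hx with h2 | h2
    · -- `x = σ x`
      have e : σ x = x := h2.symm
      rw [e, e]
    · -- `x = σ (σ x)`
      exact h2.symm

/-- The fibre over `q x` is `{x, σ x}`. [folklore] -/
theorem preimage_singleton (h : IsBranchedDoubleQuotient σ q) (x : X) :
    q ⁻¹' {q x} = {x, σ x} := by
  ext y
  simp only [mem_preimage, mem_singleton_iff, mem_insert_iff]
  rw [eq_comm, h.apply_eq_iff x y]

omit [ChartedSpace (Fin 2 → ℂ) X] in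
/-- **At a fixed point the adapted chart is real**: if `σ x = x` and `φ` is a `σ`-adapted chart at
`x` as in `exists_adapted_charts`, then `φ x = conj (φ x)`, i.e. both coordinates of `φ x` are real
(the fixed locus is the real part `{Im z = Im w = 0}` in adapted coordinates). [folklore] -/
theorem apply_fixed_eq_star {x : X} (hx : σ x = x) {φ : OpenPartialHomeomorph X (Fin 2 → ℂ)}
    (hφ : ∀ y ∈ φ.source, σ y ∈ φ.source ∧ φ (σ y) = star (φ y)) (hxφ : x ∈ φ.source) :
    φ x = star (φ x) := by
  have := (hφ x hxφ).2
  rwa [hx] at this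

end IsBranchedDoubleQuotient

end Literature.Topology.FourManifolds

end
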